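import Literature.MathematicalPhysics.QuantumFieldTheory.Balaban1983to89.B6Ineq2147TwoScaleV1
import Literature.MathematicalPhysics.QuantumFieldTheory.Balaban1983to89.B6Ineq2118TwoScaleV1Plaq

/-!
# `Balaban1983to89.B6Ineq2147TwoScaleV1Upper` — T. Bałaban, *Propagators and renormalization transformations for lattice gauge
# theories. II*, Commun. Math. Phys. **96** (1984) 223–250 [Balaban1984PropagatorsII], p. 248 after (2.147): ***"Of course we have
# also a similar bound from above"*** — `⟨B, QGQ*B⟩ ≤ γ₁′‖B‖²` for the concrete two-scale data `tsV1`, REDUCED TO THE PRINTED LOWER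
# BOUND OF THE FORM (2.122) ON THE AXIAL CONFIGURATIONS (2.121) (p. 244 *"We will prove that it is bounded from below by γ₀‖B‖² on
# the configurations B satisfying (2.121)"*, pp. 244–246), which is displayed as the only hypothesis

statement-level skeleton of published theorems with citation tags; proofs where landed; nothing here is a claim about the Yang–Mills mass gap

PDF held: `paper:balaban1984-cmp96-propagators-rt-ii` (journal page = PDF page + 222; pp. 244, 248 [PDF 22, 26] read, materialised
`~/.lit/texts/…-rt-ii/p0022.txt`, `p0026.txt`).

PRINT (verbatim).  p. 248: *"The operator C̃^{(j)}_Λ is an inverse to the operator of the quadratic form (2.120), hence it is bounded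
from below by an inverse of an upper bound of this form. Taking into account that ‖B₁‖² is bounded from below by const‖B‖², we get
⟨B, (QG^ξ_□Q*)↾_□B⟩ ≧ γ₀‖B‖² (2.147) with a positive constant γ₀ depending on d and L only. Of course we have also a similar bound
from above and an exponential decay of a kernel of the operator in (2.147)."*  p. 244: *"(we take a = 1) ‖B↾_{Λ^c}‖² +
L^{−2}‖(Q₁B)↾_{Λ′}‖² + ⟨B, Δ_jB⟩ (2.120) on the configurations B satisfying B(b) = 0 for b ⊂ Γ_{y,x}, x ∈ B(y), y ∈ Λ′. (2.121)
The form is bounded from above, and bounded from below by ‖B↾_{Λ^c}‖². There is also the bound (2.118), so let us consider the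
form ‖B↾_{Λ^c}‖² + L^{−2}‖(Q₁B)↾_{Λ′}‖² + γ₀‖∂₁B‖². (2.122) We will prove that it is bounded from below by γ₀‖B‖² on the
configurations B satisfying (2.121)."*

CITATION HEADER (lean-in-tree rule) — WHAT IS REPRODUCED.  Phase-2 file of the `lit-balaban` typed skeleton (HOME
`run/shared/lean/pub/lit-balaban/`), seat **p22 gen 10** (B6 fold owner r03, referee ref-4; lane = the Sect. C chain (2.95)–(2.147) on
the concrete two-scale data).  SKELETON rows **B6.Eq2.144** ((2.147) and the sentence after it) and **B6.Eq2.120/B6.Txt@246** (the lower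
bound of (2.120)/(2.122) on (2.121): decls of record r03's `…B6Form2122LowerBound.form2122_lower` — on `Z^d` with CORNER-anchored
trees — untouched; the V1 calculus uses centred blocks, DIVERGENCE F3, for which that lower bound is NOT in the tree).  THIS FILE:
* §1 (generic, mirror of this seat's `…B6Ineq2147TwoScaleV1.inner_covOp_ge_of_le`): for the covariance `C = ι(ι*Sι)⁻¹ι*` of a form
  symmetric and positive on `K`, **`S ≥ γ` on `K` ⇒ `⟨v, Cv⟩ ≤ γ⁻¹‖P_Kv‖² ≤ γ⁻¹‖v‖²`** (`inner_covOp_le_of_ge`, `inner_covOp_le_of_ge'`);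
  for `TwoScaleData`: **`⟨B, QGQ*B⟩ ≤ γ⁻¹‖P_{Ax}Q″*B‖²` from `Q″*aQ″ + Δ_j ≥ γ` on `Ax`** (`ineq2147_upper_of_Sb_ge`, via gen 8's (2.146));
* §2 (`tsV1`): `‖Q″B‖² ≤ (1 + L^{−d})‖B‖²` and **`‖Q″*x‖² ≤ (1 + L^{−d})‖x‖²`** (`norm_Qpp_sq_le`, `norm_adjoint_Qpp_sq_le`); the form
  (2.120) split `⟨B, (Q″*aQ″ + Δ_j)B⟩ = ⟨Q″B, aQ″B⟩ + ⟨B, Δ_jB⟩ ≥ w₀(‖B↾_{Λ^c}‖² + ‖(Q₁B)↾_{Λ′}‖²) + κΣ_p|(∂₁B)(p)|²` (weights `w ≥ w₀ > 0`,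
  (2.118) in the plaquette form of `…B6Ineq2118TwoScaleV1Plaq`), hence **from the DISPLAYED printed claim (2.122)-on-(2.121) for the
  centred trees** `h2122 : ∀ B ∈ Ax, γ_P‖B‖² ≤ ‖B↾_{Λ^c}‖² + ‖(Q₁B)↾_{Λ′}‖² + Σ_p|(∂₁B)(p)|²`: `Q″*aQ″ + Δ_j ≥ min(w₀, κ)γ_P` on `Ax`
  (`inner_Sb_ge_V1_of_2122`) and **the upper bound `⟨x, QGQ*x⟩ ≤ (min(w₀,κ)γ_P)⁻¹(1 + L^{−d})‖x‖²`** (`ineq2147_V1_upper_of_2122`).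
THEOREMS ONLY (no definition, no `def … : Prop`; the (2.122) claim is a HYPOTHESIS of the final theorem, displayed, not vendored);
standard axioms.  HONEST SCOPE: the displayed `h2122` is the p. 244 claim *"bounded from below by γ₀‖B‖² on the configurations
satisfying (2.121)"* in the unweighted form (any positive weights `1, L^{−2}, γ₀` change only `γ_P`), for the CENTRED block trees of the V1
calculus — its proof ((2.123)–(2.127) + Lemma 2.4 for centred trees) is NOT in the tree (r03's is corner-anchored on `Z^d`); the
*"exponential decay"* half of the sentence is not addressed; finite-dimensional `ℓ²` model; constants OURS; NOT summit progress.
-/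

noncomputable section

open scoped InnerProductSpace BigOperators

namespace Literature.MathematicalPhysics.QuantumFieldTheory.Balaban1983to89.B6Ineq2147TwoScaleV1Upper

/-! ## §1  Generic: a covariance is bounded above by the inverse of a lower bound of its form -/

section Cov

open B6CovarianceOperator

variable {V : Type*} [NormedAddCommGroup V] [InnerProductSpace ℝ V] [FiniteDimensional ℝ V]

/-- **`S ≥ γ` on `K` ⇒ `⟨v, Cv⟩ ≤ γ⁻¹‖P_Kv‖²`** for the covariance `C = ι(ι*Sι)⁻¹ι*` of a form symmetric and positive on `K` (with
`c = Cv ∈ K`: `γ‖c‖² ≤ ⟨c, Sc⟩ = ⟨c, P_Kv⟩ ≤ ‖c‖‖P_Kv‖` and `⟨v, Cv⟩ = ⟨c, P_Kv⟩`) — the mirror of p. 248 *"bounded from below by an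
inverse of an upper bound"*, behind *"a similar bound from above"*. [cite: Balaban1984PropagatorsII, p.248 (text after (2.147))] -/
theorem inner_covOp_le_of_ge (K : Submodule ℝ V) (S : V →ₗ[ℝ] V)
    (hpos : ∀ k : ↥K, k ≠ 0 → 0 < ⟪(k : V), S k⟫_ℝ) {γ : ℝ} (hγ : 0 < γ)
    (hlow : ∀ k : ↥K, γ * ‖(k : V)‖ ^ 2 ≤ ⟪(k : V), S k⟫_ℝ) (v : V) :
    ⟪v, covOp K S v⟫_ℝ ≤ γ⁻¹ * ‖K.starProjection v‖ ^ 2 := by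
  set c : ↥K := covOpT K S v with hc
  have hcov : covOp K S v = (c : V) := rfl
  have hproj : ∀ k' : ↥K, ⟪(k' : V), v⟫_ℝ = ⟪(k' : V), K.starProjection v⟫_ℝ := fun k' => by
    have h := Submodule.starProjection_inner_eq_zero v (k' : V) k'.2
    rw [inner_sub_left, sub_eq_zero] at h
    exact (real_inner_comm v (k' : V)).trans (h.trans (real_inner_comm (k' : V) _))
  have hsol : ⟪(c : V), S c⟫_ℝ = ⟪(c : V), K.starProjection v⟫_ℝ := by
    rw [← hproj c, ← hcov]
    exact covOp_sol K S hpos c v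
  set t := ⟪(c : V), K.starProjection v⟫_ℝ with ht
  have hvt : ⟪v, covOp K S v⟫_ℝ = t := by rw [hcov, real_inner_comm, hproj c]
  have h1 : γ * ‖(c : V)‖ ^ 2 ≤ t := by rw [← hsol]; exact hlow c
  have h2 : t ^ 2 ≤ ‖(c : V)‖ ^ 2 * ‖K.starProjection v‖ ^ 2 := by
    have h := abs_real_inner_le_norm (c : V) (K.starProjection v)
    rw [← sq_abs, ← mul_pow]
    exact pow_le_pow_left₀ (abs_nonneg _) h 2
  have ht0 : 0 ≤ t := le_trans (mul_nonneg hγ.le (sq_nonneg _)) h1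
  rw [hvt]
  rcases ht0.eq_or_lt with htz | htpos
  · rw [← htz]; positivity
  · have h3 : γ * t * t ≤ ‖K.starProjection v‖ ^ 2 * t := by
      have h4 : γ * t ^ 2 ≤ γ * (‖(c : V)‖ ^ 2 * ‖K.starProjection v‖ ^ 2) := mul_le_mul_of_nonneg_left h2 hγ.le
      have h5 : γ * ‖(c : V)‖ ^ 2 * ‖K.starProjection v‖ ^ 2 ≤ t * ‖K.starProjection v‖ ^ 2 :=
        mul_le_mul_of_nonneg_right h1 (sq_nonneg _)
      nlinarith
    have h6 : γ * t ≤ ‖K.starProjection v‖ ^ 2 := le_of_mul_le_mul_right h3 htpos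
    calc t = γ⁻¹ * (γ * t) := by rw [← mul_assoc, inv_mul_cancel₀ hγ.ne', one_mul]
      _ ≤ γ⁻¹ * ‖K.starProjection v‖ ^ 2 := mul_le_mul_of_nonneg_left h6 (inv_nonneg.2 hγ.le)

/-- … hence **`⟨v, Cv⟩ ≤ γ⁻¹‖v‖²`** (`‖P_Kv‖ ≤ ‖v‖`). [cite: Balaban1984PropagatorsII, p.248 (text after (2.147))] -/
theorem inner_covOp_le_of_ge' (K : Submodule ℝ V) (S : V →ₗ[ℝ] V)
    (hpos : ∀ k : ↥K, k ≠ 0 → 0 < ⟪(k : V), S k⟫_ℝ) {γ : ℝ} (hγ : 0 < γ)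
    (hlow : ∀ k : ↥K, γ * ‖(k : V)‖ ^ 2 ≤ ⟪(k : V), S k⟫_ℝ) (v : V) :
    ⟪v, covOp K S v⟫_ℝ ≤ γ⁻¹ * ‖v‖ ^ 2 := by
  have h1 := inner_covOp_le_of_ge K S hpos hγ hlow v
  have h2 : ‖K.starProjection v‖ ^ 2 ≤ ‖v‖ ^ 2 :=
    pow_le_pow_left₀ (norm_nonneg _) (Submodule.norm_starProjection_apply_le (K := K) v) 2
  exact h1.trans (mul_le_mul_of_nonneg_left h2 (inv_nonneg.2 hγ.le))

end Cov

/-! ### The same for the derived Sect. C operators of `TwoScaleData` -/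

section Abstract

open B6CovarianceOperator B6SectCOperators B6SectCOperators.TwoScaleData B6SectCPositivity

variable {A B W T Bs V : Type*}
  [NormedAddCommGroup A] [InnerProductSpace ℝ A] [FiniteDimensional ℝ A]
  [NormedAddCommGroup B] [InnerProductSpace ℝ B] [FiniteDimensional ℝ B]
  [NormedAddCommGroup W] [InnerProductSpace ℝ W] [FiniteDimensional ℝ W]
  [NormedAddCommGroup T] [InnerProductSpace ℝ T] [FiniteDimensional ℝ T]
  [NormedAddCommGroup Bs] [InnerProductSpace ℝ Bs] [FiniteDimensional ℝ Bs]
  [NormedAddCommGroup V] [InnerProductSpace ℝ V] [FiniteDimensional ℝ V]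
  {D : TwoScaleData A B W T Bs V}

/-- **`C̃^{(j)}_Λ ≤ γ⁻¹`**: `⟨v, C̃^{(j)}_Λv⟩ ≤ γ⁻¹‖P_{Ax}v‖²` whenever the form (2.120) satisfies `⟨B, (Q″*aQ″ + Δ_j)B⟩ ≥ γ‖B‖²` on the
axial `B`. [cite: Balaban1984PropagatorsII, p.248 (text after (2.147))] -/
theorem inner_Ct_le_of_Sb_ge (hL : D.IsLattice) (hP : D.Positive) {γ : ℝ} (hγ : 0 < γ)
    (hlow : ∀ m : ↥D.Ax, γ * ‖(m : Bs)‖ ^ 2 ≤ ⟪(m : Bs), D.Sb m⟫_ℝ) (v : Bs) :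
    ⟪v, D.Ct v⟫_ℝ ≤ γ⁻¹ * ‖D.Ax.starProjection v‖ ^ 2 :=
  inner_covOp_le_of_ge D.Ax D.Sb (Sb_pos hL hP) hγ hlow v

/-- **the upper companion of (2.147)**: `⟨B, QGQ*B⟩ = ⟨Q″*B, C̃^{(j)}_ΛQ″*B⟩ ≤ γ⁻¹‖P_{Ax}Q″*B‖²` from `Q″*aQ″ + Δ_j ≥ γ` on `Ax`.
[cite: Balaban1984PropagatorsII, p.248 (text after (2.147))] -/
theorem ineq2147_upper_of_Sb_ge (hL : D.IsLattice) (hP : D.Positive) {γ : ℝ} (hγ : 0 < γ)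
    (hlow : ∀ m : ↥D.Ax, γ * ‖(m : Bs)‖ ^ 2 ≤ ⟪(m : Bs), D.Sb m⟫_ℝ) (x : V) :
    ⟪x, D.Q (D.G (LinearMap.adjoint D.Q x))⟫_ℝ ≤ γ⁻¹ * ‖D.Ax.starProjection (LinearMap.adjoint D.Qpp x)‖ ^ 2 := by
  rw [B6Eq2146TwoScale.eq2146_printed hL hP x]
  exact inner_Ct_le_of_Sb_ge hL hP hγ hlow _

end Abstract

/-! ## §2  For `tsV1`: `‖Q″*x‖² ≤ (1 + L^{−d})‖x‖²`, the form split, and the upper bound from the displayed (2.122) -/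

section TwoScale

open B6SectCOperators B6SectCOperators.TwoScaleData B6SectCTwoScaleV1 B6SectCTwoScaleV1Lattice LatticeFieldCalculus
open B5SectBStatements (eta)
open B6Ineq2118TwoScaleV1 (kappa_pos)
open B6Ineq2147TwoScaleV1 (inner_Qpp_a_le)

variable {P : Params} {c : ℝ} (hc : c ≠ 0) {j : ℕ} (hj : j + 1 ≤ P.m + P.K) (Λ' : Finset (Site P (j + 1)))
  {w : CIdx j Λ' → ℝ} (hw : ∀ i, 0 < w i) {w₀ : ℝ}

include hj in
/-- **`‖Q″B‖² ≤ (1 + L^{−d})‖B‖²`** (the `Λ^c`-part is a restriction, the `Λ′`-part is bounded by `Σ_c|(Q₁B)(c)|² ≤ L^{−d}‖B‖²`; this seat's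
`inner_Qpp_a_le` at unit weights). [cite: Balaban1984PropagatorsII, (2.119) p.243] -/
theorem norm_Qpp_sq_le (b : UBond P j) : ‖Qpp P j Λ' b‖ ^ 2 ≤ (1 + ((P.L : ℝ) ^ P.d)⁻¹) * ‖b‖ ^ 2 := by
  have h := inner_Qpp_a_le (w := fun _ => (1 : ℝ)) (W := 1) hj Λ' zero_le_one (fun _ => le_rfl) b
  have ha : aW P j Λ' (fun _ => (1 : ℝ)) (Qpp P j Λ' b) = Qpp P j Λ' b := by
    ext i
    rw [aW_apply, one_mul]
  rw [ha, real_inner_self_eq_norm_sq, one_mul] at h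
  exact h

include hj in
/-- **`‖Q″*x‖² ≤ (1 + L^{−d})‖x‖²** (`‖Q″*‖ = ‖Q″‖`: `‖Q″*x‖⁴ = ⟨x, Q″Q″*x⟩² ≤ ‖x‖²‖Q″Q″*x‖²`). [cite: Balaban1984PropagatorsII, (2.144) p.248] -/
theorem norm_adjoint_Qpp_sq_le (x : CSpace j Λ') :
    ‖LinearMap.adjoint (Qpp P j Λ') x‖ ^ 2 ≤ (1 + ((P.L : ℝ) ^ P.d)⁻¹) * ‖x‖ ^ 2 := by
  set v := LinearMap.adjoint (Qpp P j Λ') x with hv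
  have hM : (0 : ℝ) < 1 + ((P.L : ℝ) ^ P.d)⁻¹ := by
    have : (0 : ℝ) < (P.L : ℝ) ^ P.d := pow_pos (Nat.cast_pos.2 P.L_pos) _
    positivity
  have h1 : ‖v‖ ^ 2 = ⟪x, Qpp P j Λ' v⟫_ℝ := by
    rw [← real_inner_self_eq_norm_sq, hv, LinearMap.adjoint_inner_left]
  have h2 : ⟪x, Qpp P j Λ' v⟫_ℝ ^ 2 ≤ ‖x‖ ^ 2 * ‖Qpp P j Λ' v‖ ^ 2 := by
    have h := abs_real_inner_le_norm x (Qpp P j Λ' v)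
    rw [← sq_abs, ← mul_pow]
    exact pow_le_pow_left₀ (abs_nonneg _) h 2
  have h3 := norm_Qpp_sq_le hj Λ' v
  have h4 : ‖v‖ ^ 2 * ‖v‖ ^ 2 ≤ ((1 + ((P.L : ℝ) ^ P.d)⁻¹) * ‖x‖ ^ 2) * ‖v‖ ^ 2 := by
    have h5 : ⟪x, Qpp P j Λ' v⟫_ℝ ^ 2 ≤ ‖x‖ ^ 2 * ((1 + ((P.L : ℝ) ^ P.d)⁻¹) * ‖v‖ ^ 2) :=
      h2.trans (mul_le_mul_of_nonneg_left h3 (sq_nonneg _))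
    rw [← h1] at h5
    nlinarith
  rcases (sq_nonneg ‖v‖).eq_or_lt with h0 | hpos
  · rw [← h0]; positivity
  · exact le_of_mul_le_mul_right h4 hpos

/-- the form (2.120) of `tsV1` splits as printed: `⟨B, (Q″*aQ″ + Δ_j)B⟩ = ⟨Q″B, aQ″B⟩ + ⟨B, Δ_jB⟩`.
[cite: Balaban1984PropagatorsII, (2.120) p.244] -/
theorem inner_Sb_split (b : UBond P j) :
    ⟪b, (tsV1 hc Λ' w).Sb b⟫_ℝ = ⟪Qpp P j Λ' b, aW P j Λ' w (Qpp P j Λ' b)⟫_ℝ + ⟪b, (tsV1 hc Λ' w).Δj b⟫_ℝ := by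
  rw [Sb, LinearMap.add_apply, inner_add_right]
  simp only [LinearMap.coe_comp, Function.comp_apply]
  rw [LinearMap.adjoint_inner_right]
  rfl

/-- `⟨Q″B, aQ″B⟩ ≥ w₀(Σ_{b∈Λ^c}|B(b)|² + Σ_{c∈Λ′}|(Q₁B)(c)|²)` for weights `w ≥ w₀`. [cite: Balaban1984PropagatorsII, (2.120) p.244] -/
theorem inner_Qpp_a_ge (hw0 : ∀ i, w₀ ≤ w i) (b : UBond P j) :
    w₀ * (∑ o : OutBond j Λ', b o.1 ^ 2 + ∑ e : InBond j Λ', bondAvg (WithLp.ofLp b) e.1 ^ 2) ≤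
      ⟪Qpp P j Λ' b, aW P j Λ' w (Qpp P j Λ' b)⟫_ℝ := by
  have h1 : ⟪Qpp P j Λ' b, aW P j Λ' w (Qpp P j Λ' b)⟫_ℝ = ∑ i, w i * Qpp P j Λ' b i ^ 2 := by
    rw [PiLp.inner_apply]
    refine Finset.sum_congr rfl fun i _ => ?_
    rw [aW_apply]
    simp only [RCLike.inner_apply, conj_trivial]
    ring
  have h2 : ∑ i, Qpp P j Λ' b i ^ 2 = ∑ o : OutBond j Λ', b o.1 ^ 2 + ∑ e : InBond j Λ', bondAvg (WithLp.ofLp b) e.1 ^ 2 := by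
    rw [Fintype.sum_sum_type]
    rfl
  rw [h1, ← h2, Finset.mul_sum]
  exact Finset.sum_le_sum fun i _ => mul_le_mul_of_nonneg_right (hw0 i) (sq_nonneg _)

include hj hw in
/-- **from the DISPLAYED printed claim (2.122)-on-(2.121)** (p. 244: the form `‖B↾_{Λ^c}‖² + ‖(Q₁B)↾_{Λ′}‖² + Σ_p|(∂₁B)(p)|²` is `≥ γ_P‖B‖²` on
the axial configurations — here for the CENTRED trees of the V1 calculus, unweighted) **the operator of (2.120) is `≥ min(w₀, κ)γ_P` on the
axial `B`** (weights `w ≥ w₀ > 0`; (2.118) in plaquette form, `κ = c²/(η^dL^{2j})`). [cite: Balaban1984PropagatorsII, (2.120)–(2.122) p.244] -/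
theorem inner_Sb_ge_V1_of_2122 (hw₀ : 0 < w₀) (hw0 : ∀ i, w₀ ≤ w i) {γP : ℝ}
    (h2122 : ∀ B : UBond P j, B ∈ axial P j Λ' → γP * ‖B‖ ^ 2 ≤
      ∑ o : OutBond j Λ', B o.1 ^ 2 + ∑ e : InBond j Λ', bondAvg (WithLp.ofLp B) e.1 ^ 2 +
        ∑ p : Plaq P j, curl 1 (WithLp.ofLp B) p ^ 2)
    (m : ↥(tsV1 hc Λ' w).Ax) :
    min w₀ (c ^ 2 / (eta P.L j ^ P.d * ((P.L : ℝ) ^ j) ^ 2)) * γP * ‖(m : UBond P j)‖ ^ 2 ≤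
      ⟪(m : UBond P j), (tsV1 hc Λ' w).Sb m⟫_ℝ := by
  set κ := c ^ 2 / (eta P.L j ^ P.d * ((P.L : ℝ) ^ j) ^ 2) with hκ
  have hκ0 : 0 < κ := kappa_pos (P := P) hc (j := j)
  have hmin0 : 0 ≤ min w₀ κ := le_min hw₀.le hκ0.le
  set X := ∑ o : OutBond j Λ', (m : UBond P j) o.1 ^ 2 + ∑ e : InBond j Λ', bondAvg (WithLp.ofLp (m : UBond P j)) e.1 ^ 2 with hX
  set D := ∑ p : Plaq P j, curl 1 (WithLp.ofLp (m : UBond P j)) p ^ 2 with hD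
  have hX0 : 0 ≤ X := add_nonneg (Finset.sum_nonneg fun _ _ => sq_nonneg _) (Finset.sum_nonneg fun _ _ => sq_nonneg _)
  have hD0 : 0 ≤ D := Finset.sum_nonneg fun _ _ => sq_nonneg _
  have h1 := h2122 (m : UBond P j) m.2
  have h2 := inner_Qpp_a_ge Λ' hw0 (m : UBond P j)
  have h3 : κ * D ≤ ⟪(m : UBond P j), (tsV1 hc Λ' w).Δj m⟫_ℝ := by
    have h := (B6Ineq2118TwoScaleV1Plaq.ineq2118_V1_plaq hc hj Λ' hw (WithLp.ofLp (m : UBond P j))).1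
    rw [WithLp.toLp_ofLp] at h
    exact h
  rw [inner_Sb_split]
  have h4 : min w₀ κ * X ≤ w₀ * X := mul_le_mul_of_nonneg_right (min_le_left _ _) hX0
  have h5 : min w₀ κ * D ≤ κ * D := mul_le_mul_of_nonneg_right (min_le_right _ _) hD0
  calc min w₀ κ * γP * ‖(m : UBond P j)‖ ^ 2 = min w₀ κ * (γP * ‖(m : UBond P j)‖ ^ 2) := by ring
    _ ≤ min w₀ κ * (X + D) := mul_le_mul_of_nonneg_left h1 hmin0
    _ = min w₀ κ * X + min w₀ κ * D := by ring
    _ ≤ w₀ * X + κ * D := add_le_add h4 h5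
    _ ≤ _ := add_le_add h2 h3

include hj hw in
/-- **p. 248 *"Of course we have also a similar bound from above"* FOR `tsV1`, from the displayed (2.122)-on-(2.121) claim**:
`⟨x, QGQ*x⟩ ≤ (min(w₀, κ)γ_P)⁻¹(1 + L^{−d})‖x‖²` for every `x` on `𝔅 = Λ^c ∪ Λ′` (`Q = Q″Q_j`, `G = Δ_a⁻¹` of (2.95); `γ_P` the constant
of the displayed lower bound, `w ≥ w₀ > 0` the weights, `κ = c²/(η^dL^{2j})`). [cite: Balaban1984PropagatorsII, p.248 (text after (2.147))] -/
theorem ineq2147_V1_upper_of_2122 (hw₀ : 0 < w₀) (hw0 : ∀ i, w₀ ≤ w i) {γP : ℝ} (hγP : 0 < γP)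
    (h2122 : ∀ B : UBond P j, B ∈ axial P j Λ' → γP * ‖B‖ ^ 2 ≤
      ∑ o : OutBond j Λ', B o.1 ^ 2 + ∑ e : InBond j Λ', bondAvg (WithLp.ofLp B) e.1 ^ 2 +
        ∑ p : Plaq P j, curl 1 (WithLp.ofLp B) p ^ 2)
    (x : CSpace j Λ') :
    ⟪x, (tsV1 hc Λ' w).Q ((tsV1 hc Λ' w).G (LinearMap.adjoint (tsV1 hc Λ' w).Q x))⟫_ℝ ≤
      (min w₀ (c ^ 2 / (eta P.L j ^ P.d * ((P.L : ℝ) ^ j) ^ 2)) * γP)⁻¹ * (1 + ((P.L : ℝ) ^ P.d)⁻¹) * ‖x‖ ^ 2 := by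
  have hκ0 : 0 < c ^ 2 / (eta P.L j ^ P.d * ((P.L : ℝ) ^ j) ^ 2) := kappa_pos (P := P) hc (j := j)
  have hγ : 0 < min w₀ (c ^ 2 / (eta P.L j ^ P.d * ((P.L : ℝ) ^ j) ^ 2)) * γP := mul_pos (lt_min hw₀ hκ0) hγP
  have h1 := ineq2147_upper_of_Sb_ge (isLattice Λ' hc hj hw) (positive Λ' hc hj w) hγ
    (inner_Sb_ge_V1_of_2122 hc hj Λ' hw hw₀ hw0 h2122) x
  have h2 : ‖(tsV1 hc Λ' w).Ax.starProjection (LinearMap.adjoint (tsV1 hc Λ' w).Qpp x)‖ ^ 2 ≤ (1 + ((P.L : ℝ) ^ P.d)⁻¹) * ‖x‖ ^ 2 :=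
    (pow_le_pow_left₀ (norm_nonneg _) (Submodule.norm_starProjection_apply_le (K := (tsV1 hc Λ' w).Ax) _) 2).trans
      (norm_adjoint_Qpp_sq_le hj Λ' x)
  calc ⟪x, (tsV1 hc Λ' w).Q ((tsV1 hc Λ' w).G (LinearMap.adjoint (tsV1 hc Λ' w).Q x))⟫_ℝ
      ≤ (min w₀ (c ^ 2 / (eta P.L j ^ P.d * ((P.L : ℝ) ^ j) ^ 2)) * γP)⁻¹ *
          ‖(tsV1 hc Λ' w).Ax.starProjection (LinearMap.adjoint (tsV1 hc Λ' w).Qpp x)‖ ^ 2 := h1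
    _ ≤ (min w₀ (c ^ 2 / (eta P.L j ^ P.d * ((P.L : ℝ) ^ j) ^ 2)) * γP)⁻¹ * ((1 + ((P.L : ℝ) ^ P.d)⁻¹) * ‖x‖ ^ 2) :=
        mul_le_mul_of_nonneg_left h2 (inv_nonneg.2 hγ.le)
    _ = _ := by ring

end TwoScale

end Literature.MathematicalPhysics.QuantumFieldTheory.Balaban1983to89.B6Ineq2147TwoScaleV1Upper

end
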